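import Summits.QuantumFields.BalabanUV.Beta.GAN24.S3ShapeL0
import Summits.QuantumFields.BalabanUV.Beta.GAN24.S3ShapeL0ContractionSymAt
import Summits.QuantumFields.BalabanUV.Beta.GAN24.E3UnitSplitLevelsSymAt

/-!
# Road S3, row S3-L0 AT THE SYM TABLE: the END **`rowL0_holds_at`** — the level-`0` Λ lineage (the sym `S₀` stencil pushed `n+1` times) is a local stencil family with constant
# `c₀L·(Lc⁻¹)^{n+1}` BEFORE the root, UNCONDITIONAL at `d = 3` (sym twin of `S3ShapeL0At`)

NOT IN PRINT — OUR BOOKKEEPING (road-P2 = `b2b-balaban-gan24-p2` gen 56, 2026-08-25; row G-an2-4 ∕ (CONV-C), the (α-0) chain at row D1's literal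
OF RECORD (III′) `JsB12CombShSym`; [folklore] composition BY NAME; 0 `def`, 0 cite, 0 `def … : Prop`, 0 `sorry`).  Weight 0.  NEVER «G-an2-4 closed» as (CONV-C);
NOT D1, NOT BetaPertH, NOT continuum, NOT Clay; NO campaign opened (an2 W-4) — typed while idle under R-2 as a brick of the located `hUg-Λ` transfer
(road-P2 MEMO M-gan24p2-g56-1, `gen56/S-CAMPAIGN-SIZING-g56.v0_4.md` §2(a)).

METHOD = the OWNER gan24-p1's gen-6 `mkroot.py` rule (road-P2's `tools/mksym.py`): the ROOTED file VERBATIM with an1's SYM table `symHessFFAt (toSite r) Lc` (`r ∈ box (d+1) Lc`)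
in place of the rooted `hessFFAt (toSite r) Lc` and the symmetrised increment `E3UnitSplitLevelsSymAt.symLagrIncAt` (M.66) in place of asym's `SpineRooted.lagrIncAt`; an1's sym
support ∕ entry ∕ `biLoc` lemmas (`symHessKerAt_eq_zero_left ∕ _right`, `abs_symHessKerAt_le ≤ 2ℓ²`, `symHessFFAt_inl_*`, `biLoc_symHessFFAt` — SAME constants as the rooted ones) and
(ρ-a)-sym `TaylorMassLamSymAt` (M.65) where the rooted file reads an1's rooted lemmas ∕ (ρ-a); every ROOT-FREE lemma of the base modules BY NAME (not re-declared); same theorem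
names in the `…SymAt` namespace; base and rooted modules untouched; no zero-root bridge (the sym table has no root-0 base twin).
Discharges NOTHING of (hS, hSall), the K-slot or BetaPertH by itself.
## Contents
the `S3ShapeL0At` chain VERBATIM over `S3ShapeL0ContractionSymAt` and (ρ-b)-sym `E3UnitSplitLevelsSymAt.e3Lam0_unit_split`; END `rowL0_holds_at`.
-/

noncomputable section

open Finset
open scoped BigOperators
open Literature.MathematicalPhysics.QuantumFieldTheory
open Literature.MathematicalPhysics.QuantumFieldTheory.Balaban1983to89
open Literature.MathematicalPhysics.QuantumFieldTheory.Balaban1983to89.Beta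
open Literature.Probability.LatticeModels (Torus.proj)
open B12Sec2to5 (l1 l1_nonneg)
open ExpKernelCalculus (MKer Zl BiLoc Decays)
open LatticeForm (quo)
open KernelSpecInstance (wH)
open KKTFluctuationKernel (GamΦ)
open OneStepResolventKernel (Fib LocStencil KInv)
open AffineAveraging (box toSite)
open AveragingHessianKernels (hessFF hessKer Near ell)
open Summit.QuantumFields.BalabanUV.Beta.SymAveragingHessianCounts (symHessFFAt symHessKerAt symHessFFAt_inl_inl symHessFFAt_inl_inr symHessFFAt_inr
  symHessKerAt_eq_zero_left symHessKerAt_eq_zero_right abs_symHessKerAt_le biLoc_symHessFFAt)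
open InterLevelTransport (SLam cwsum cwsum_apply onLat onLat_zsmul onLat_off)
open BalabanStepJets (lamCoeffOf)
open Summit.QuantumFields.BalabanUV.Beta.GAN24.E3UnitSplit (e3OfS e3OfS_inl_inr e3OfS_inr)
open Summit.QuantumFields.BalabanUV.Beta.GAN24.TaylorSandwich (sandwich_bound)
open Summit.QuantumFields.BalabanUV.Beta.GAN24.S3ShapeL0Contraction (l1_le_of_mem_colBox leg_onLat)
open Summit.QuantumFields.BalabanUV.Beta.GAN24.S3ShapeL0ContractionSymAt (inner_eq_onLat support_onLat_symHessFFAt mass_onLat_symHessFFAt)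
open Summit.QuantumFields.BalabanUV.Beta.GAN24.TaylorLamVertexPairing (abs_vertexPair_le quo_quo)
open Summit.QuantumFields.BalabanUV.Beta.GAN24.StencilSlotE3PhiLeg (phiLeg_three)
open Summit.QuantumFields.BalabanUV.Beta.GAN24.StencilSlotE3HLeg (legs_three)
open Summit.QuantumFields.BalabanUV.Beta.GAN24.S3ShapeL0 (wPhi_bound_of_phiLeg bracket_bound)

namespace Summit.QuantumFields.BalabanUV.Beta.GAN24.S3ShapeL0SymAt

section Row

variable {Lc : ℕ} [NeZero Lc]

/-- **ROW S3-L0 AT THE IN-BLOCK ROOT, FROM THE TWO OUTER LEGS AND THE BRACKET BOUND** [folklore] (`d = 3`, every box root `rr ∈ box (3+1) Lc`, constant BEFORE the root; conclusion = the hypothesis `hL0` of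
`StencilSlotE3OfPieces.e3Shape_of_pieces` VERBATIM — `∃ c₀L, S3.ShapeL0 3 Lc cΛ c₀L (Lc·r) (κ∕2)` — binder `hL0` of the TREE module `StencilSlotE3OfPieces` (p206983; staged 2cc3c5eb8d83de1a) verbatim at `d = 3`).
INPUTS (hypotheses, discharged BY NAME elsewhere): `hH`∕`hG` = the vertex∕right and left legs in `StencilSlotE3HLeg.legs_three`'s literal shape
((N1), leaf-16's `FineReadoutDecay.exists_wH_decay`, re-currencied by the row owner); `hβ` = THE BRACKET BOUND
`|N^{3+2}·Σ_{κ″}Σ'_v wH_N κ″ κ′ (v − N•u′)·lamCoeffOf (KInv Lc) Lc μ yy κ″ v| ≤ Cβ·r^{j+1}·e^{−κ|quo_N(Lc•yy) − u′|₁}`, `N = Lc^{j+1}`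
(leaf-18's `TaylorLamVertexPairing.abs_vertexPair_le` + `StencilSlotE3PhiLeg.phiLeg_three` give it with `r = Lc⁻²`, hence `θ = Lc·r = Lc⁻¹`).
PROOF: `e3Lam0_unit_split` → `inner_eq_onLat` under the sandwich → `TaylorSandwich.sandwich_bound` with the synthetic pair (CH = Cβ·r^p, the §2 mass)
→ `|−(cΛ∕Lc⁴)·N^{3−2}|·bound = c₀L·(Lc·r)^{n+1}·e^{−(κ∕2)(|x′−u′|₁+|z′−u′|₁)}`; the off-diagonal∕multiplier blocks of `e3OfS` vanish (`e3OfS_inl_inr`, `e3OfS_inr`).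
Nothing of (hS, hSall) is discharged; NOT BetaPertH, NOT continuum, NOT Clay. -/
theorem rowL0_of_bracket_at (hLc : 1 ≤ Lc) (cΛ : ℝ) {C κ Cβ r : ℝ} (hκ : 0 < κ) (hC : 0 ≤ C) (hCβ : 0 ≤ Cβ) (hr : 0 ≤ r)
    (hH : ∀ (j : ℕ) (k l : Fin (3 + 1)) (u u' : Fin (3 + 1) → ℤ),
      |((Lc : ℝ) ^ (j + 1)) ^ (3 + 2) * wH (N := Lc ^ (j + 1)) k l (u - (((Lc ^ (j + 1) : ℕ) : ℤ)) • u')| ≤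
        C * Real.exp (-κ * l1 (quo (Lc ^ (j + 1)) u - u')))
    (hG : ∀ (j : ℕ) (α l : Fin (3 + 1)) (x' w : Fin (3 + 1) → ℤ),
      |((Lc : ℝ) ^ (j + 1)) ^ (3 + 2) * GamΦ (N := Lc ^ (j + 1)) α x' l w| ≤
        C * Real.exp (-κ * l1 (x' - quo (Lc ^ (j + 1)) w)))
    (hβ : ∀ (j : ℕ) (κ' μ : Fin (3 + 1)) (u' yy : Fin (3 + 1) → ℤ),
      |((Lc : ℝ) ^ (j + 1)) ^ (3 + 2) * ∑ κ'' : Fin (3 + 1), ∑' v : Fin (3 + 1) → ℤ,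
          wH (N := Lc ^ (j + 1)) κ'' κ' (v - (((Lc ^ (j + 1) : ℕ) : ℤ)) • u') *
            lamCoeffOf (KInv (N := Lc) (d := 3)) Lc μ yy κ'' v| ≤
        Cβ * r ^ (j + 1) * Real.exp (-κ * l1 (quo (Lc ^ (j + 1)) ((Lc : ℤ) • yy) - u'))) :
    ∃ c₀L : ℝ, 0 ≤ c₀L ∧ ∀ (rr : Fin (3 + 1) → ℕ), rr ∈ box (3 + 1) Lc → ∀ n : ℕ,
      LocStencil (fun κ' u' x' z' a b => ((Lc : ℝ) ^ (n + 1 + 1)) ^ (2 * (3 + 1)) *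
        e3OfS (Lc ^ (n + 1 + 1)) (fun κ u => (((Lc : ℝ) ^ (3 + 1)) ^ (n + 1) * cΛ) •
          SLam Lc (lamCoeffOf (KInv (N := Lc) (d := 3)) Lc) (fun μ y => symHessFFAt (toSite rr) Lc μ y) κ u) κ' u' x' z' a b)
        (c₀L * ((Lc : ℝ) * r) ^ (n + 1)) (κ / 2) := by
  -- the `n`-free constants
  set Mass : ℝ := (((2 * (2 * Lc) + 1) ^ (3 + 1) : ℕ) : ℝ) * ((3 + 1) * ((3 + 1) *
    ((((2 * (2 * Lc) + 1) ^ (3 + 1) : ℕ) : ℝ) * (2 * (ell (3 + 1) Lc : ℝ) ^ 2)))) with hMass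
  set R : ℝ := ((3 : ℝ) + 1) * ((2 * Lc : ℕ) : ℝ) with hR
  set E : ℝ := Real.exp (κ * (R + (3 + 1))) with hE
  set K : ℝ := (3 + 1) * (C * C * Cβ * Mass * (E * E)) * Zl (3 + 1) (κ / 2) with hK
  have hL0 : (0 : ℝ) < Lc := by exact_mod_cast Nat.pos_of_ne_zero (NeZero.ne Lc)
  have hR0 : 0 ≤ R := by rw [hR]; positivity
  have hMass0 : 0 ≤ Mass := by rw [hMass]; positivity
  have hZ : 0 ≤ Zl (3 + 1) (κ / 2) := ExpKernelCalculus.Zl_nonneg (by positivity)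
  have hK0 : 0 ≤ K := by rw [hK]; positivity
  refine ⟨|cΛ| / (Lc : ℝ) ^ (3 + 1) * K * ((Lc : ℝ) * r), by positivity, fun rr hrr n => ?_⟩
  intro κ' u' x' z' a b
  dsimp only
  have hrhs0 : 0 ≤ |cΛ| / (Lc : ℝ) ^ (3 + 1) * K * ((Lc : ℝ) * r) * ((Lc : ℝ) * r) ^ (n + 1) *
      Real.exp (-(κ / 2) * (l1 (x' - u') + l1 (z' - u'))) := by positivity
  rcases a with α | μ₀
  · rcases b with β | ν₀
    · -- the field–field block: template, vertex contraction, sandwich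
      rw [E3UnitSplitLevelsSymAt.e3Lam0_unit_split (Lc := Lc) (d := 3) (toSite rr) cΛ (n + 1) (n + 1 + 1) rfl κ' u' x' z' α β]
      simp_rw [inner_eq_onLat hrr]
      set p : ℕ := n + 1 + 1 with hp
      have hN1 : (1 : ℝ) ≤ ((Lc ^ p : ℕ) : ℝ) := by exact_mod_cast Nat.one_le_pow _ _ (Nat.pos_of_ne_zero (NeZero.ne Lc))
      -- the sandwich bound with the synthetic vertex pair
      have hS := sandwich_bound (N := Lc ^ p) (d := 3) (κ := κ) (CA := C) (CB := C) (CH := Cβ * r ^ p) (Mass := Mass)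
        (RW := R) (RU := R) (x' := x') (u' := u') (z' := z')
        (A := fun l w => ((Lc : ℝ) ^ p) ^ (3 + 2) * GamΦ (N := Lc ^ p) α x' l w)
        (B := fun l' y => ((Lc : ℝ) ^ p) ^ (3 + 2) * wH (N := Lc ^ p) l' β (y - (((Lc ^ p : ℕ) : ℤ)) • z'))
        (H := fun μ u => onLat Lc (fun yy => ((Lc : ℝ) ^ p) ^ (3 + 2) * ∑ κ'' : Fin (3 + 1), ∑' v : Fin (3 + 1) → ℤ,
          wH (N := Lc ^ p) κ'' κ' (v - (((Lc ^ p : ℕ) : ℤ)) • u') * lamCoeffOf (KInv (N := Lc) (d := 3)) Lc μ yy κ'' v) u)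
        (T := fun μ u w l y l' => onLat Lc (fun yy => -symHessFFAt (toSite rr) Lc μ yy) u w y (Sum.inl l) (Sum.inl l'))
        (Sw := fun y => Fintype.piFinset (fun i => Finset.Icc (y i - ((2 * Lc : ℕ) : ℤ)) (y i + ((2 * Lc : ℕ) : ℤ))))
        (Su := fun y => Fintype.piFinset (fun i => Finset.Icc (y i - ((2 * Lc : ℕ) : ℤ)) (y i + ((2 * Lc : ℕ) : ℤ))))
        hκ (fun l w => hG (n + 1) α l x' w) (fun l' y => hH (n + 1) l' β y z')
        (fun μ u => leg_onLat (N := Lc ^ p) (by positivity) (fun μ yy => hβ (n + 1) κ' μ u' yy) μ u)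
        (fun μ u w l y l' h => (support_onLat_symHessFFAt hrr h).1) (fun μ u w l y l' h => (support_onLat_symHessFFAt hrr h).2)
        (fun y w hw => l1_le_of_mem_colBox hw) (fun y u hu => l1_le_of_mem_colBox hu)
        (fun y l' => mass_onLat_symHessFFAt hLc hrr y l')
      -- the level-dependent transfer factors are at most `E`
      have hEN : Real.exp (κ * (R / ((Lc ^ p : ℕ) : ℝ) + (3 + 1))) ≤ E := by
        rw [hE, Real.exp_le_exp]
        have : R / ((Lc ^ p : ℕ) : ℝ) ≤ R := div_le_self hR0 hN1
        nlinarith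
      have hE0 : 0 ≤ Real.exp (κ * (R / ((Lc ^ p : ℕ) : ℝ) + (3 + 1))) := (Real.exp_pos _).le
      have hbnd : (3 + 1) * (C * C * (Cβ * r ^ p) * Mass *
          (Real.exp (κ * (R / ((Lc ^ p : ℕ) : ℝ) + (3 + 1))) * Real.exp (κ * (R / ((Lc ^ p : ℕ) : ℝ) + (3 + 1))))) *
          Zl (3 + 1) (κ / 2) ≤ K * r ^ p := by
        rw [hK]
        have h2 : Real.exp (κ * (R / ((Lc ^ p : ℕ) : ℝ) + (3 + 1))) * Real.exp (κ * (R / ((Lc ^ p : ℕ) : ℝ) + (3 + 1))) ≤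
            E * E := mul_le_mul hEN hEN hE0 ((Real.exp_pos _).le)
        have h3 : 0 ≤ (3 + 1 : ℝ) * (C * C * (Cβ * r ^ p) * Mass) * Zl (3 + 1) (κ / 2) := by positivity
        nlinarith
      have hz : ((Lc : ℝ) ^ p) ^ (((3 : ℕ) : ℤ) - 2) = (Lc : ℝ) ^ p := by norm_num
      rw [hz]
      simp only [Nat.cast_pow, Nat.cast_ofNat] at hS hbnd ⊢
      have hpref : |-(cΛ / (Lc : ℝ) ^ (3 + 1)) * (Lc : ℝ) ^ p| = |cΛ| / (Lc : ℝ) ^ (3 + 1) * (Lc : ℝ) ^ p := by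
        rw [abs_mul, abs_neg, abs_div, abs_of_pos (pow_pos hL0 _), abs_of_pos (pow_pos hL0 _)]
      rw [abs_mul, hpref]
      have hfin : |cΛ| / (Lc : ℝ) ^ (3 + 1) * (Lc : ℝ) ^ p * (K * r ^ p * Real.exp (-(κ / 2) * (l1 (x' - u') + l1 (z' - u')))) =
          |cΛ| / (Lc : ℝ) ^ (3 + 1) * K * ((Lc : ℝ) * r) * ((Lc : ℝ) * r) ^ (n + 1) *
            Real.exp (-(κ / 2) * (l1 (x' - u') + l1 (z' - u'))) := by
        rw [hp]; ring
      rw [← hfin]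
      refine mul_le_mul_of_nonneg_left (hS.trans ?_) (by positivity)
      exact mul_le_mul_of_nonneg_right hbnd (Real.exp_pos _).le
    · rw [e3OfS_inl_inr, mul_zero, abs_zero]
      exact hrhs0
  · rw [e3OfS_inr, mul_zero, abs_zero]
    exact hrhs0

/-- **ROW S3-L0 AT THE IN-BLOCK ROOT FROM THE TWO OUTER LEGS ALONE, θ = Lc⁻¹** [folklore] (`d = 3`, constants BEFORE `∀ rr ∈ box`): the (N1)-legs in `StencilSlotE3HLeg.legs_three`'s literal currency
imply `∃ c₀L δL, 0 < δL ∧ ∀ n, LocStencil (row S3-L0's function at member n+2) (c₀L·(Lc⁻¹)^{n+1}) δL` — i.e. `∃ c₀L δL, 0 < δL ∧ S3.ShapeL0 3 Lc cΛ c₀L Lc⁻¹ δL`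
(binder `hL0` of the TREE module `StencilSlotE3OfPieces` (p206983; staged 2cc3c5eb8d83de1a) verbatim at `d = 3`); `δL = min(κ, δ_Φ)∕2` with `δ_Φ` the K-slot rate of `StencilSlotE3PhiLeg.phiLeg_three` (unconditional at
`d = 3`), the bracket bound by `bracket_bound` (leaf-18's `TaylorLamVertexPairing.abs_vertexPair_le`).  One hypothesis of `e3Shape_of_pieces`; discharges
NOTHING of (hS, hSall) by itself; NOT BetaPertH, NOT continuum, NOT Clay. -/
theorem rowL0_of_legs_at (hLc : 1 ≤ Lc) (cΛ : ℝ) {C κ : ℝ} (hκ : 0 < κ) (hC : 0 ≤ C)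
    (hH : ∀ (j : ℕ) (k l : Fin (3 + 1)) (u u' : Fin (3 + 1) → ℤ),
      |((Lc : ℝ) ^ (j + 1)) ^ (3 + 2) * wH (N := Lc ^ (j + 1)) k l (u - (((Lc ^ (j + 1) : ℕ) : ℤ)) • u')| ≤
        C * Real.exp (-κ * l1 (quo (Lc ^ (j + 1)) u - u')))
    (hG : ∀ (j : ℕ) (α l : Fin (3 + 1)) (x' w : Fin (3 + 1) → ℤ),
      |((Lc : ℝ) ^ (j + 1)) ^ (3 + 2) * GamΦ (N := Lc ^ (j + 1)) α x' l w| ≤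
        C * Real.exp (-κ * l1 (x' - quo (Lc ^ (j + 1)) w))) :
    ∃ c₀L δL : ℝ, 0 ≤ c₀L ∧ 0 < δL ∧ ∀ (rr : Fin (3 + 1) → ℕ), rr ∈ box (3 + 1) Lc → ∀ n : ℕ,
      LocStencil (fun κ' u' x' z' a b => ((Lc : ℝ) ^ (n + 1 + 1)) ^ (2 * (3 + 1)) *
        e3OfS (Lc ^ (n + 1 + 1)) (fun κ u => (((Lc : ℝ) ^ (3 + 1)) ^ (n + 1) * cΛ) •
          SLam Lc (lamCoeffOf (KInv (N := Lc) (d := 3)) Lc) (fun μ y => symHessFFAt (toSite rr) Lc μ y) κ u) κ' u' x' z' a b)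
        (c₀L * ((Lc : ℝ)⁻¹) ^ (n + 1)) δL := by
  obtain ⟨CΦ, δ, hδ, hCΦ, hΦ1, -⟩ := phiLeg_three (Lc := Lc)
  set κ₀ : ℝ := min κ δ with hκ₀
  have hκ₀pos : 0 < κ₀ := lt_min hκ hδ
  have hκ₀κ : κ₀ ≤ κ := min_le_left _ _
  have hκ₀δ : κ₀ ≤ δ := min_le_right _ _
  have hL : (0 : ℝ) < Lc := by exact_mod_cast Nat.pos_of_ne_zero (NeZero.ne Lc)
  -- legs and bracket at the common rate κ₀
  have hH' : ∀ (j : ℕ) (k l : Fin (3 + 1)) (u u' : Fin (3 + 1) → ℤ),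
      |((Lc : ℝ) ^ (j + 1)) ^ (3 + 2) * wH (N := Lc ^ (j + 1)) k l (u - (((Lc ^ (j + 1) : ℕ) : ℤ)) • u')| ≤
        C * Real.exp (-κ₀ * l1 (quo (Lc ^ (j + 1)) u - u')) := fun j k l u u' =>
    OneStepResolventKernel.bound_mono (hH j k l u u') hC le_rfl hκ₀κ (l1_nonneg _)
  have hG' : ∀ (j : ℕ) (α l : Fin (3 + 1)) (x' w : Fin (3 + 1) → ℤ),
      |((Lc : ℝ) ^ (j + 1)) ^ (3 + 2) * GamΦ (N := Lc ^ (j + 1)) α x' l w| ≤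
        C * Real.exp (-κ₀ * l1 (x' - quo (Lc ^ (j + 1)) w)) := fun j α l x' w =>
    OneStepResolventKernel.bound_mono (hG j α l x' w) hC le_rfl hκ₀κ (l1_nonneg _)
  have hCβ : 0 ≤ CΦ * Real.exp δ * (Lc : ℝ)⁻¹ := by positivity
  have hβ' : ∀ (j : ℕ) (κ' μ : Fin (3 + 1)) (u' yy : Fin (3 + 1) → ℤ),
      |((Lc : ℝ) ^ (j + 1)) ^ (3 + 2) * ∑ κ'' : Fin (3 + 1), ∑' v : Fin (3 + 1) → ℤ,
          wH (N := Lc ^ (j + 1)) κ'' κ' (v - (((Lc ^ (j + 1) : ℕ) : ℤ)) • u') *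
            lamCoeffOf (KInv (N := Lc) (d := 3)) Lc μ yy κ'' v| ≤
        CΦ * Real.exp δ * (Lc : ℝ)⁻¹ * (((Lc : ℝ)⁻¹) ^ 2) ^ (j + 1) *
          Real.exp (-κ₀ * l1 (quo (Lc ^ (j + 1)) ((Lc : ℤ) • yy) - u')) := fun j κ' μ u' yy =>
    OneStepResolventKernel.bound_mono (bracket_bound hδ.le (wPhi_bound_of_phiLeg hΦ1) j κ' μ u' yy)
      (by positivity) le_rfl hκ₀δ (l1_nonneg _)
  obtain ⟨c₀L, hc₀, h⟩ := rowL0_of_bracket_at hLc cΛ hκ₀pos hC hCβ (by positivity) hH' hG' hβ'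
  refine ⟨c₀L, κ₀ / 2, hc₀, by positivity, fun rr hrr n => ?_⟩
  have e : (Lc : ℝ) * ((Lc : ℝ)⁻¹) ^ 2 = (Lc : ℝ)⁻¹ := by field_simp
  rw [← e]
  exact h rr hrr n

/-- **ROW S3-L0 HOLDS AT `d = 3` AT EVERY IN-BLOCK ROOT, θ = Lc⁻¹, CONSTANTS BEFORE THE ROOT** [folklore] (the OWNER gan24-p1-g21's requested END `rowL0_holds_at` of package (ρ-d); the hypothesis of his `BornLambdaUndressedRow.exists_hUg_of_rootedRows`): for every `Lc ≥ 1` and every weight `cΛ`,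
`∃ c₀L δL, 0 < δL ∧ ∀ n, LocStencil (row S3-L0's function at member n+2) (c₀L·(Lc⁻¹)^{n+1}) δL` — the hypothesis `hL0` of
`StencilSlotE3OfPieces.e3Shape_of_pieces` (binder `hL0` of the TREE module `StencilSlotE3OfPieces` (p206983; staged 2cc3c5eb8d83de1a) verbatim at `d = 3`) with `θ = Lc⁻¹` (`< 1` iff `Lc ≥ 2`): the (N1)-legs
from `StencilSlotE3HLeg.legs_three` (leaf-16's `FineReadoutDecay.exists_wH_decay`, re-currencied by the row owner) fed to `rowL0_of_legs`.
ONE of the twelve analytic rows of the S-slot table; it discharges NOTHING of (hS, hSall) by itself; «E3Shape»∕«E3SupRate» need all twelve;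
NOT BetaPertH, NOT continuum, NOT Clay. -/
theorem rowL0_holds_at (hLc : 1 ≤ Lc) (cΛ : ℝ) :
    ∃ c₀L δL : ℝ, 0 ≤ c₀L ∧ 0 < δL ∧ ∀ (r : Fin (3 + 1) → ℕ), r ∈ box (3 + 1) Lc → ∀ n : ℕ,
      LocStencil (fun κ' u' x' z' a b => ((Lc : ℝ) ^ (n + 1 + 1)) ^ (2 * (3 + 1)) *
        e3OfS (Lc ^ (n + 1 + 1)) (fun κ u => (((Lc : ℝ) ^ (3 + 1)) ^ (n + 1) * cΛ) •
          SLam Lc (lamCoeffOf (KInv (N := Lc) (d := 3)) Lc) (fun μ y => symHessFFAt (toSite r) Lc μ y) κ u) κ' u' x' z' a b)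
        (c₀L * ((Lc : ℝ)⁻¹) ^ (n + 1)) δL := by
  obtain ⟨C, κ, hκ, hC, hH, hG⟩ := legs_three (Lc := Lc)
  exact rowL0_of_legs_at hLc cΛ hκ hC hH hG


/-- **ROOTED ROW S3-L0 IN THE END'S BINDER SHAPE** [folklore] (`d = 3`, `Lc ≥ 2`, ∀ in-block roots after the constants): `∃ c₀L θ δ, 0 ≤ c₀L ∧ 0 ≤ θ ∧ θ < 1 ∧ 0 < δ ∧ hL0` — literally
`∃ c₀L θ δ, … ∧ S3.ShapeL0 3 Lc cΛ c₀L θ δ` with the END's side conditions on `(θ, δ)` (ref2 r35 (l): the row carries its own `θ_row = Lc⁻¹ < 1`,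
`δ_row > 0`); the assembler weakens `(c₀L, θ, δ)` to the table's common values by `LocStencil` monotonicity.  Discharges NOTHING of (hS, hSall)
by itself; NOT BetaPertH, NOT continuum, NOT Clay. -/
theorem rowL0_shape_at (hLc : 2 ≤ Lc) (cΛ : ℝ) :
    ∃ c₀L θ δ : ℝ, 0 ≤ c₀L ∧ 0 ≤ θ ∧ θ < 1 ∧ 0 < δ ∧ ∀ (r : Fin (3 + 1) → ℕ), r ∈ box (3 + 1) Lc → ∀ n : ℕ,
      LocStencil (fun κ' u' x' z' a b => ((Lc : ℝ) ^ (n + 1 + 1)) ^ (2 * (3 + 1)) *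
        e3OfS (Lc ^ (n + 1 + 1)) (fun κ u => (((Lc : ℝ) ^ (3 + 1)) ^ (n + 1) * cΛ) •
          SLam Lc (lamCoeffOf (KInv (N := Lc) (d := 3)) Lc) (fun μ y => symHessFFAt (toSite r) Lc μ y) κ u) κ' u' x' z' a b)
        (c₀L * θ ^ (n + 1)) δ := by
  obtain ⟨c₀L, δL, hc₀, hδL, h⟩ := rowL0_holds_at (Lc := Lc) (le_trans (by norm_num) hLc) cΛ
  have hL : (2 : ℝ) ≤ Lc := by exact_mod_cast hLc
  refine ⟨c₀L, (Lc : ℝ)⁻¹, δL, hc₀, by positivity, ?_, hδL, h⟩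
  rw [inv_lt_one_iff₀]
  exact Or.inr (by linarith)


end Row

end Summit.QuantumFields.BalabanUV.Beta.GAN24.S3ShapeL0SymAt

end
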